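import Summits.Ventures.Crystal3D.Bulk.GapLinkConsecutive
import Summits.Ventures.Crystal3D.Bulk.GapDegreesSharp
import Summits.Ventures.Crystal3D.Bulk.GapCensusRows
import HarnessLib

/-!
# F2 in the kernel: every vertex link of the tight graph is a subgraph of a path ("links are
# linear forests") — the fan around a vertex is never closed, and the packaged statement

HONEST FRAMING. Part of the venture `Summits/Ventures/Crystal3D` (cell `pub-crystal3d`, phase 2;
seat p2, PROMOTION-AUDIT prep). Kernel theorems about ADMISSIBLE fourteen-ball configurations
(`IsGapConfig c`) in the window `1.0515 ≤ D`, `D² < 12/7` (`D < 1.309` ⊇ the census window); no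
extremality, no plane map, no face; nothing here asserts anything about GAP(1.26), no census
number moves. Sequel of `Bulk/GapLinkConsecutive.lean` (F2 (a): touching tight partners of a
ball are cyclically consecutive around it). Here:

* **F2 (b)** `IsGapConfig.exists_consecutive_not_touch_shell` (`D² < 12/7`, `d ≥ 3`): some two
  cyclically consecutive partners of a shell ball do NOT touch — else every gap is a
  tight-triangle corner `≤ α₀` (a gap `> π` is excluded by the other `≥ 2` gaps, each
  `≥ A_x > α₀/2`) and `2π = Σ gaps ≤ 5 α₀ < 2π` (`d ≤ 5`, `IsGapConfig.card_tight_le_five`);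
  `IsGapConfig.exists_consecutive_not_touch_intruder` (`1.0515 ≤ D`, `D² < 2`): the same at the
  hole (`d ≤ 4`, `A_p(D) < π/2`).
* packaging: `adjacent_of_consecutive`, `link_listing_of_adjacent`, and **`IsGapConfig.link_subset_path`** (`_shell`, `_intruder`):
  for every ball `i ≠ 0` with `k + 1` tight partners there is an injective listing `f` of
  `tightNbrs c i` such that `f s'` touches `f s` with `s < s'` ONLY IF `s' = s + 1` — the link of
  `i` is a subgraph of the path `f 0 — ⋯ — f k` (maximum degree `≤ 2`, no cycle) = the predicate
  `links_linear_forests` of `alp.py` (filter F2) for the tight graph of every admissible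
  configuration in the window (A-family dossier F-A2); `CensusRows.link_subset_path` (the same
  under `CensusRows c` + `1.0515 ≤ D`); `IsGapConfig.card_link_le_two` (alp's first test
  literally: every partner touches at most two other partners).

NOT here: the identification of the abstract plantri map with the tight graph (the enumeration
premise P-L3 / Lemma L shared by every row). References: engine-4's F2 note
(`phase2/ENV-CENSUS/DESIGN.md` §2); Musin–Tarasov, DCG 48 (2012) §3 [`MusinTarasov2012`];
Flatley et al., J. Comput. Appl. Math. 254 (2013), Lemma 6 (1)–(3) [`FlatleyEtAl2013`].
-/

noncomputable section

open scoped BigOperators InnerProductSpace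
open Finset Real

namespace Summit.Ventures.Crystal3D

/-! ## §1 F2 (b): the fan around a vertex is never closed -/

section Claims

open Literature.Geometry.DiscreteGeometry InnerProductGeometry

variable {c : Fin 14 → EuclideanSpace ℝ (Fin 3)}

/-- **F2 (b) at a shell ball: the fan is never closed** — if a shell ball `i` has `d ≥ 3` tight
partners, some two cyclically consecutive ones do NOT touch (admissible configuration with
`D² < 12/7`, so `d ≤ 5`: otherwise every gap would be a tight-triangle corner `≤ α₀` and
`2π = Σ gaps ≤ 5 α₀ < 2π`). -/
theorem IsGapConfig.exists_consecutive_not_touch_shell (hc : IsGapConfig c)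
    (hD : intruderDist c ^ 2 < 12 / 7) {i : Fin 14} (hi0 : i ≠ 0) (hi13 : i ≠ 13) {k : ℕ}
    (hd : (tightAngles c i).card = k + 1) (hk : 2 ≤ k) :
    ∃ m : Fin (k + 1),
      dist (c (tightNbrAt c i hd (finRotate (k + 1) m))) (c (tightNbrAt c i hd m)) ≠ 1 := by
  have hD1 := hc.one_le_intruderDist
  have hD83 : intruderDist c ^ 2 < 8 / 3 := by linarith
  obtain ⟨hD2, hD3⟩ : intruderDist c < 2 ∧ intruderDist c ^ 2 < 3 := ⟨by nlinarith, by linarith⟩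
  set D := intruderDist c with hDdef
  obtain ⟨hC1, hC2, hC3, hC4⟩ := Cx_bounds hD1 hD83
  by_contra H
  push Not at H
  have hk0 : k ≠ 0 := by omega
  -- every gap has cosine ≥ 1/3
  have hcosge : ∀ m, 1 / 3 ≤ Real.cos (tightGap c i hd m) := by
    intro m
    have hjm := tightNbrAt_mem c i hd m
    have hj'm := tightNbrAt_mem c i hd (finRotate (k + 1) m)
    have hcoseq := hc.cos_tightAzimuth_sub hD2 hi0 hjm hj'm
    rw [tightAzimuth_tightNbrAt, tightAzimuth_tightNbrAt, ← cos_tightGap] at hcoseq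
    rw [hcoseq]
    obtain ⟨hj0, -, hdj⟩ := mem_tightNbrs.1 hjm
    obtain ⟨hj'0, -, hdj'⟩ := mem_tightNbrs.1 hj'm
    have hne : tightNbrAt c i hd (finRotate (k + 1) m) ≠ tightNbrAt c i hd m := fun h =>
      finRotate_succ_ne hk0 m (tightNbrAt_injective c i hd h)
    have ht := H m
    by_cases hj13 : tightNbrAt c i hd m = 13
    · have hj'13 : tightNbrAt c i hd (finRotate (k + 1) m) ≠ 13 := fun h => hne (h.trans hj13.symm)
      rw [hj13] at hdj ht ⊢
      rw [hc.corner_eq_arccos_Ax hD2 hi0 hi13 hj'0 hj'13 hdj' hdj ht,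
        Real.cos_arccos (by linarith) hC2.le]
      exact hC1
    · by_cases hj'13 : tightNbrAt c i hd (finRotate (k + 1) m) = 13
      · rw [hj'13] at hdj' ht ⊢
        rw [corner_comm, hc.corner_eq_arccos_Ax hD2 hi0 hi13 hj0 hj13 hdj hdj'
          (by rw [dist_comm]; exact ht), Real.cos_arccos (by linarith) hC2.le]
        exact hC1
      · rw [hc.corner_eq_arccos_third hi0 hi13 hj'0 hj'13 hj0 hj13 hdj' hdj ht,
          Real.cos_arccos (by norm_num) (by norm_num)]
  -- gap lower bound and sum
  have hgap : ∀ t, Real.arccos (D / (√3 * √(4 - D ^ 2))) ≤ tightGap c i hd t :=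
    fun t => hc.Ax_le_tightGap hD83 hi0 hi13 hd t
  have hsum := sum_tightGap c i hd
  have h2ψ : Real.arccos (1 / 3) < 2 * Real.arccos (D / (√3 * √(4 - D ^ 2))) := by
    by_contra hle
    push Not at hle
    have := cos_le_cos_of_nonneg_of_le_pi
      (by linarith [Real.arccos_nonneg (D / (√3 * √(4 - D ^ 2)))]) (Real.arccos_le_pi _) hle
    rw [Real.cos_arccos (by norm_num) (by norm_num)] at this
    linarith [cos_two_Ax_lt_third hD1 hD83]
  -- every gap ≤ α₀
  have hle : ∀ m, tightGap c i hd m ≤ Real.arccos (1 / 3) := by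
    intro m
    have hpos := tightGap_pos c i hd m
    by_cases hmπ : tightGap c i hd m ≤ π
    · calc tightGap c i hd m = Real.arccos (Real.cos (tightGap c i hd m)) :=
            (arccos_cos hpos.1.le hmπ).symm
        _ ≤ Real.arccos (1 / 3) := arccos_le_arccos (hcosge m)
    · push Not at hmπ
      exfalso
      -- the other gaps sum to `2π − gap ≤ α₀`, but they are `k ≥ 2` gaps each `≥ A_x`
      have h1 : 2 * π - tightGap c i hd m ≤ Real.arccos (1 / 3) :=
        calc 2 * π - tightGap c i hd m = Real.arccos (Real.cos (2 * π - tightGap c i hd m)) :=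
              (arccos_cos (by linarith) (by linarith)).symm
          _ ≤ Real.arccos (1 / 3) := by
              apply arccos_le_arccos; rw [Real.cos_two_pi_sub]; exact hcosge m
      have h2 := sum_erase_ge (fun t => tightGap c i hd t) hsum hgap m
      have hk2 : (2 : ℝ) ≤ k := by exact_mod_cast hk
      have hψ0 : 0 ≤ Real.arccos (D / (√3 * √(4 - D ^ 2))) := Real.arccos_nonneg _
      nlinarith
  -- `2π = Σ gaps ≤ (k+1) α₀ ≤ 5 α₀ < 2π`
  have hcard : k + 1 ≤ 5 := by
    have h5 := hc.card_tight_le_five hi0 hi13 hD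
    have hset : (univ.filter fun j : Fin 14 => j ≠ 0 ∧ j ≠ i ∧ dist (c i) (c j) = 1) =
        tightNbrs c i := rfl
    rwa [hset, ← hc.card_tightAngles hD3 hi0, hd] at h5
  have hs : ∑ m, tightGap c i hd m ≤ (univ : Finset (Fin (k + 1))).card • Real.arccos (1 / 3) :=
    Finset.sum_le_card_nsmul _ _ _ fun m _ => hle m
  rw [Finset.card_univ, Fintype.card_fin, nsmul_eq_mul, hsum] at hs
  have h5 : ((k + 1 : ℕ) : ℝ) ≤ 5 := by exact_mod_cast hcard
  have hα := Literature.Geometry.DiscreteGeometry.arccos_third_lt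
  have hα0 : 0 ≤ Real.arccos (1 / 3 : ℝ) := Real.arccos_nonneg _
  nlinarith [pi_gt_d2]

/-- **F2 (b) at the hole: the fan around the hole is never closed** — with
`1.0515 ≤ D`, `D² < 2` (so `d ≤ 4` hole contacts) and `d ≥ 3`, some two cyclically consecutive
hole contacts do not touch (else `2π = Σ gaps = d · A_p(D) < 4 · π/2`). -/
theorem IsGapConfig.exists_consecutive_not_touch_intruder (hc : IsGapConfig c)
    (hDlo : (1.0515 : ℝ) ≤ intruderDist c) (hD2' : intruderDist c ^ 2 < 2) {k : ℕ}
    (hd : (tightAngles c 13).card = k + 1) (hk : 2 ≤ k) :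
    ∃ m : Fin (k + 1),
      dist (c (tightNbrAt c 13 hd (finRotate (k + 1) m))) (c (tightNbrAt c 13 hd m)) ≠ 1 := by
  have hD1 := hc.one_le_intruderDist
  obtain ⟨hD2, hD3⟩ : intruderDist c < 2 ∧ intruderDist c ^ 2 < 3 := ⟨by nlinarith, by linarith⟩
  have h13 : (13 : Fin 14) ≠ 0 := by decide
  set D := intruderDist c with hDdef
  obtain ⟨hC1, hC2⟩ := Cp_bounds hD1 hD2'
  set ψ := Real.arccos ((2 - D ^ 2) / (4 - D ^ 2)) with hψ
  by_contra H
  push Not at H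
  have hk0 : k ≠ 0 := by omega
  have hcoseq' : ∀ m, Real.cos (tightGap c 13 hd m) = (2 - D ^ 2) / (4 - D ^ 2) := by
    intro m
    have hjm := tightNbrAt_mem c 13 hd m
    have hj'm := tightNbrAt_mem c 13 hd (finRotate (k + 1) m)
    have hcoseq := hc.cos_tightAzimuth_sub hD2 h13 hjm hj'm
    rw [tightAzimuth_tightNbrAt, tightAzimuth_tightNbrAt, ← cos_tightGap] at hcoseq
    rw [hcoseq]
    obtain ⟨hj0, hj13, hdj⟩ := mem_tightNbrs.1 hjm
    obtain ⟨hj'0, hj'13, hdj'⟩ := mem_tightNbrs.1 hj'm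
    rw [dist_comm] at hdj hdj'
    rw [hc.corner_eq_arccos_Ap hD2 hj'0 hj'13 hj0 hj13 hdj' hdj (H m),
      Real.cos_arccos (by linarith) (by linarith)]
  have hgap : ∀ t, ψ ≤ tightGap c 13 hd t := fun t => hc.Ap_le_tightGap hD3 hd t
  have hsum := sum_tightGap c 13 hd
  have hψpos : 0 < ψ := by
    rw [hψ]; exact Real.arccos_pos.2 (by linarith)
  have hψlt : ψ < π / 2 := Real.arccos_lt_pi_div_two.2 hC1
  -- every gap equals ψ (≤ ψ suffices)
  have hle : ∀ m, tightGap c 13 hd m ≤ ψ := by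
    intro m
    have hpos := tightGap_pos c 13 hd m
    by_cases hmπ : tightGap c 13 hd m ≤ π
    · calc tightGap c 13 hd m = Real.arccos (Real.cos (tightGap c 13 hd m)) :=
            (arccos_cos hpos.1.le hmπ).symm
        _ ≤ ψ := arccos_le_arccos (hcoseq' m).ge
    · push Not at hmπ
      exfalso
      have h1 : 2 * π - tightGap c 13 hd m ≤ ψ :=
        calc 2 * π - tightGap c 13 hd m = Real.arccos (Real.cos (2 * π - tightGap c 13 hd m)) :=
              (arccos_cos (by linarith) (by linarith)).symm
          _ ≤ ψ := by
              apply arccos_le_arccos; rw [Real.cos_two_pi_sub]; exact (hcoseq' m).ge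
      have h2 := sum_erase_ge (fun t => tightGap c 13 hd t) hsum hgap m
      have hk2 : (2 : ℝ) ≤ k := by exact_mod_cast hk
      nlinarith
  have hcard : k + 1 ≤ 4 := by
    have h4 := hc.card_intruderContacts_le_four_of_le hDlo hD2
    have hset : (univ.filter fun j : Fin 14 => j ≠ 0 ∧ j ≠ 13 ∧ dist (c 13) (c j) = 1) =
        tightNbrs c 13 := rfl
    rwa [hset, ← hc.card_tightAngles hD3 h13, hd] at h4
  have hs : ∑ m, tightGap c 13 hd m ≤ (univ : Finset (Fin (k + 1))).card • ψ :=
    Finset.sum_le_card_nsmul _ _ _ fun m _ => hle m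
  rw [Finset.card_univ, Fintype.card_fin, nsmul_eq_mul, hsum] at hs
  have h4 : ((k + 1 : ℕ) : ℝ) ≤ 4 := by exact_mod_cast hcard
  nlinarith [pi_pos]

end Claims

/-! ## §2 F2 packaged: the link of every vertex is a subgraph of a path -/

section Packaging

open Literature.Geometry.DiscreteGeometry

variable {c : Fin 14 → EuclideanSpace ℝ (Fin 3)}

/-- From the `m < m'` form to the symmetric `±1` form in `Fin (k+1)` arithmetic. -/
theorem adjacent_of_consecutive {k : ℕ} {p q : Fin (k + 1)} (hlt : p < q)
    (h : q.val = p.val + 1 ∨ (p.val = 0 ∧ q.val = k)) : q = p + 1 ∨ p = q + 1 := by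
  rcases h with h1 | ⟨h0, hk⟩
  · left
    have hp : p < Fin.last k := lt_of_lt_of_le hlt (Fin.le_last q)
    exact Fin.ext (by rw [Fin.val_add_one_of_lt hp, h1])
  · right
    rw [show q = Fin.last k from Fin.ext (by rw [hk, Fin.val_last]),
      show p = 0 from Fin.ext (by rw [h0, Fin.val_zero]), Fin.last_add_one]

/-- **Path packaging at a vertex.** If every tight partner of ball `i` has a position in the
cyclic order (`hcov`), touching positions are cyclically consecutive (`hcons`), and — with `≥ 3`
partners — some consecutive pair does NOT touch (`hopen`), then re-indexing the cyclic order from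
just after that pair lists the partners injectively as `f 0, …, f k` with touching partners
ADJACENT in the list: the link is a subgraph of the path `f 0 — f 1 — ⋯ — f k`. -/
theorem link_listing_of_adjacent (c : Fin 14 → EuclideanSpace ℝ (Fin 3)) (i : Fin 14) {k : ℕ}
    (hd : (tightAngles c i).card = k + 1)
    (hcov : ∀ j ∈ tightNbrs c i, ∃ m, tightNbrAt c i hd m = j)
    (hcons : ∀ m m' : Fin (k + 1), m < m' →
      dist (c (tightNbrAt c i hd m')) (c (tightNbrAt c i hd m)) = 1 →
        m'.val = m.val + 1 ∨ (m.val = 0 ∧ m'.val = k))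
    (hopen : 2 ≤ k → ∃ m₀ : Fin (k + 1),
      dist (c (tightNbrAt c i hd (finRotate (k + 1) m₀))) (c (tightNbrAt c i hd m₀)) ≠ 1) :
    ∃ f : Fin (k + 1) → Fin 14, Function.Injective f ∧ (∀ s, f s ∈ tightNbrs c i) ∧
      (∀ j ∈ tightNbrs c i, ∃ s, f s = j) ∧
      ∀ s s' : Fin (k + 1), s < s' → dist (c (f s')) (c (f s)) = 1 → s'.val = s.val + 1 := by
  -- symmetric `±1` form of `hcons`
  have hadj : ∀ p q : Fin (k + 1), p ≠ q →
      dist (c (tightNbrAt c i hd q)) (c (tightNbrAt c i hd p)) = 1 → q = p + 1 ∨ p = q + 1 := by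
    intro p q hpq ht
    rcases lt_or_gt_of_ne hpq with h | h
    · exact adjacent_of_consecutive h (hcons p q h ht)
    · rw [dist_comm] at ht
      exact (adjacent_of_consecutive h (hcons q p h ht)).symm
  by_cases hk : 2 ≤ k
  · obtain ⟨m₀, hm₀⟩ := hopen hk
    rw [finRotate_apply] at hm₀
    refine ⟨fun s => tightNbrAt c i hd (m₀ + 1 + s), ?_, ?_, ?_, ?_⟩
    · intro s s' h; exact add_left_cancel (tightNbrAt_injective c i hd h)
    · intro s; exact tightNbrAt_mem c i hd _
    · intro j hj
      obtain ⟨m, hm⟩ := hcov j hj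
      exact ⟨m - (m₀ + 1), by simp only; rw [add_sub_cancel]; exact hm⟩
    · intro s s' hss' ht
      simp only at ht
      have hne : m₀ + 1 + s ≠ m₀ + 1 + s' := fun h => (ne_of_lt hss') (add_left_cancel h)
      rcases hadj _ _ hne ht with h | h
      · have hs : s' = s + 1 := add_left_cancel (by rw [h]; abel)
        have hlt : s < Fin.last k := lt_of_lt_of_le hss' (Fin.le_last s')
        rw [hs, Fin.val_add_one_of_lt hlt]
      · exfalso
        have hs : s = s' + 1 := add_left_cancel (by rw [h]; abel)
        by_cases hl : s' = Fin.last k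
        · rw [hl, Fin.last_add_one] at hs
          have e1 : m₀ + 1 + Fin.last k = m₀ := by
            rw [add_assoc, add_comm 1, Fin.last_add_one, add_zero]
          rw [hs, hl, e1, add_zero, dist_comm] at ht
          exact hm₀ ht
        · have hlt : s' < Fin.last k := lt_of_le_of_ne (Fin.le_last s') hl
          have := Fin.val_add_one_of_lt hlt
          have h2 := Fin.lt_def.1 hss'
          rw [hs, this] at h2
          omega
  · push Not at hk
    refine ⟨fun s => tightNbrAt c i hd s, tightNbrAt_injective c i hd, tightNbrAt_mem c i hd,
      hcov, ?_⟩
    intro s s' hss' _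
    have h1 := Fin.lt_def.1 hss'
    have h2 := s'.isLt
    omega

/-- **F2 at a shell ball: the link is a subgraph of a path** (`D² < 12/7`): an injective
listing `f 0, …, f k` of the tight partners of the shell ball `i` in which touching partners
are adjacent. -/
theorem IsGapConfig.link_subset_path_shell (hc : IsGapConfig c)
    (hD : intruderDist c ^ 2 < 12 / 7) {i : Fin 14} (hi0 : i ≠ 0) (hi13 : i ≠ 13) {k : ℕ}
    (hd : (tightAngles c i).card = k + 1) :
    ∃ f : Fin (k + 1) → Fin 14, Function.Injective f ∧ (∀ s, f s ∈ tightNbrs c i) ∧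
      (∀ j ∈ tightNbrs c i, ∃ s, f s = j) ∧
      ∀ s s' : Fin (k + 1), s < s' → dist (c (f s')) (c (f s)) = 1 → s'.val = s.val + 1 := by
  have hD83 : intruderDist c ^ 2 < 8 / 3 := by linarith
  have hD3 : intruderDist c ^ 2 < 3 := by linarith
  exact link_listing_of_adjacent c i hd (fun j hj => hc.exists_tightNbrAt_eq hD3 hi0 hd hj)
    (fun m m' h ht => hc.touch_consecutive_shell hD83 hi0 hi13 hd h ht)
    (fun hk => hc.exists_consecutive_not_touch_shell hD hi0 hi13 hd hk)

/-- **F2 at the hole: the link of the intruder is a subgraph of a path** (`1.0515 ≤ D`,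
`D² < 2`). -/
theorem IsGapConfig.link_subset_path_intruder (hc : IsGapConfig c)
    (hDlo : (1.0515 : ℝ) ≤ intruderDist c) (hD2' : intruderDist c ^ 2 < 2) {k : ℕ}
    (hd : (tightAngles c 13).card = k + 1) :
    ∃ f : Fin (k + 1) → Fin 14, Function.Injective f ∧ (∀ s, f s ∈ tightNbrs c 13) ∧
      (∀ j ∈ tightNbrs c 13, ∃ s, f s = j) ∧
      ∀ s s' : Fin (k + 1), s < s' → dist (c (f s')) (c (f s)) = 1 → s'.val = s.val + 1 := by
  have hD3 : intruderDist c ^ 2 < 3 := by linarith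
  exact link_listing_of_adjacent c 13 hd
    (fun j hj => hc.exists_tightNbrAt_eq hD3 (by decide) hd hj)
    (fun m m' h ht => hc.touch_consecutive_intruder hD2' hd h ht)
    (fun hk => hc.exists_consecutive_not_touch_intruder hDlo hD2' hd hk)

/-- **F2 (links are linear forests) for every vertex of the tight graph of an admissible
configuration in the census window** (`1.0515 ≤ D`, `D² < 12/7` — covers `1.25 ≤ D ≤ 1.26` and
indeed every `D ≤ 1.26` with hole degree `≤ 4`): for every ball `i ≠ 0` with `k + 1` tight partners
there is an injective listing `f` of `tightNbrs c i` in which two partners touch only if they are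
ADJACENT — the link of `i` is a subgraph of the path `f 0 — ⋯ — f k`: maximum degree `≤ 2`, no
cycle. This is the pre-LP filter F2 of `alp.py` (`links_linear_forests`) as a kernel fact, face-free
(no plane map, no extremality: vertex star + R-min/R-tri + the degree rows only). -/
theorem IsGapConfig.link_subset_path (hc : IsGapConfig c) (hDlo : (1.0515 : ℝ) ≤ intruderDist c)
    (hD : intruderDist c ^ 2 < 12 / 7) {i : Fin 14} (hi0 : i ≠ 0) {k : ℕ}
    (hd : (tightAngles c i).card = k + 1) :
    ∃ f : Fin (k + 1) → Fin 14, Function.Injective f ∧ (∀ s, f s ∈ tightNbrs c i) ∧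
      (∀ j ∈ tightNbrs c i, ∃ s, f s = j) ∧
      ∀ s s' : Fin (k + 1), s < s' → dist (c (f s')) (c (f s)) = 1 → s'.val = s.val + 1 := by
  by_cases hi13 : i = 13
  · subst hi13
    exact hc.link_subset_path_intruder hDlo (by linarith) hd
  · exact hc.link_subset_path_shell hD hi0 hi13 hd

/-- **F2 under the kernel rows of the census** (`CensusRows c`, `Bulk/GapCensusRows.lean`: in
particular `IsGapConfig c` and `intruderDist c ≤ 1.26`) and the hole-degree threshold
`1.0515 ≤ intruderDist c` of `CensusRows.card_intruderContacts_le_four` (every census cell has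
`D ≥ 1.25`): the link of every ball `i ≠ 0` in the tight graph is a subgraph of a path. -/
theorem CensusRows.link_subset_path (h : CensusRows c) (hDlo : (1.0515 : ℝ) ≤ intruderDist c)
    {i : Fin 14} (hi0 : i ≠ 0) {k : ℕ} (hd : (tightAngles c i).card = k + 1) :
    ∃ f : Fin (k + 1) → Fin 14, Function.Injective f ∧ (∀ s, f s ∈ tightNbrs c i) ∧
      (∀ j ∈ tightNbrs c i, ∃ s, f s = j) ∧
      ∀ s s' : Fin (k + 1), s < s' → dist (c (f s')) (c (f s)) = 1 → s'.val = s.val + 1 := by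
  have h1 := h.intruderDist_le
  exact h.isGapConfig.link_subset_path hDlo (by nlinarith) hi0 hd

/-- **F2, literal form of `alp.py`'s first test (`if c > 2: return False`): every tight partner
`a` of a ball `i` touches at most TWO other tight partners of `i`** (admissible configuration,
`1.0515 ≤ D`, `D² < 12/7`). From `link_subset_path`: the partners touching `a = f s₀` sit at the
positions `s₀ − 1`, `s₀ + 1` of the listing. (The second test, "no cycle in the link", is the
path statement itself: a subgraph of a path is acyclic.) -/
theorem IsGapConfig.card_link_le_two (hc : IsGapConfig c) (hDlo : (1.0515 : ℝ) ≤ intruderDist c)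
    (hD : intruderDist c ^ 2 < 12 / 7) {i : Fin 14} (hi0 : i ≠ 0) {k : ℕ}
    (hd : (tightAngles c i).card = k + 1) {a : Fin 14} (ha : a ∈ tightNbrs c i) :
    ((tightNbrs c i).filter fun b => dist (c a) (c b) = 1).card ≤ 2 := by
  classical
  obtain ⟨f, -, -, hsurj, hadj⟩ := hc.link_subset_path hDlo hD hi0 hd
  obtain ⟨s₀, hs₀⟩ := hsurj a ha
  set P : Fin (k + 1) → Prop := fun s => s.val + 1 = s₀.val ∨ s₀.val + 1 = s.val with hP
  have hsub : ((tightNbrs c i).filter fun b => dist (c a) (c b) = 1) ⊆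
      (univ.filter P).image f := by
    intro b hb
    rw [mem_filter] at hb
    obtain ⟨s, hs⟩ := hsurj b hb.1
    rw [mem_image]
    refine ⟨s, mem_filter.2 ⟨mem_univ _, ?_⟩, hs⟩
    rcases lt_trichotomy s s₀ with h | h | h
    · left
      have := hadj s s₀ h (by rw [hs₀, hs]; exact hb.2)
      omega
    · exfalso
      rw [h, hs₀] at hs
      rw [← hs, dist_self] at hb
      exact zero_ne_one hb.2
    · right
      have := hadj s₀ s h (by rw [hs₀, hs, dist_comm]; exact hb.2)
      omega
  have hP2 : (univ.filter P).card ≤ 2 := by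
    have hval : Set.InjOn Fin.val ((univ.filter P : Finset (Fin (k + 1))) : Set (Fin (k + 1))) :=
      fun s _ t _ hst => Fin.ext hst
    have hmap : ∀ s ∈ (univ.filter P), s.val ∈ ({s₀.val - 1, s₀.val + 1} : Finset ℕ) := by
      intro s hs
      have hs' := (mem_filter.1 hs).2
      rw [mem_insert, mem_singleton]
      rcases hs' with h | h
      · left; omega
      · right; omega
    calc (univ.filter P).card ≤ ({s₀.val - 1, s₀.val + 1} : Finset ℕ).card :=
          Finset.card_le_card_of_injOn Fin.val hmap hval
      _ ≤ 2 := by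
          calc ({s₀.val - 1, s₀.val + 1} : Finset ℕ).card
              ≤ ({s₀.val + 1} : Finset ℕ).card + 1 := Finset.card_insert_le _ _
            _ = 2 := by rw [card_singleton]
  calc ((tightNbrs c i).filter fun b => dist (c a) (c b) = 1).card
      ≤ ((univ.filter P).image f).card := Finset.card_le_card hsub
    _ ≤ (univ.filter P).card := Finset.card_image_le
    _ ≤ 2 := hP2

end Packaging

end Summit.Ventures.Crystal3D
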